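import Summits.CriticalPhenomena.SAWScalingLimit.Theses.SAWWeldingIdentification

/-!
# `Assembly` (route `SAWWeldingIdentification`, item stmt-CriticalPhenomena-11048)

The assembly-kind record `Assembly` of route `SAWWeldingIdentification` (sub-problem
`SAWScalingLimit`), item stmt-CriticalPhenomena-11048 (ledger name `TraceFactsChain`). Its body is
the closing implication

`WeldingLawOfLimit → RemovableLimit → EventualTight → WeldingSetup → WeldingRigidity →
  SLERemovableChord → IdentifyFromWelding → LimitUpgrade → ChordalSLE83Exists → SAWScalingLimit`,

identical to the sibling records `Assembly2` (stmt-CriticalPhenomena-4510, proved in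
`SAWWeldingIdentificationAssembly2.lean`) and `Assembly22` (stmt-CriticalPhenomena-6920, proved in
`SAWWeldingIdentificationAssembly22.lean`), and literally the type of the route's PROVED deciding
theorem `closes` (Theses file: complete the Dobrushin domain to a conformal rectangle; take a chordal
SLE_{8/3} random curve `Γ` (`ChordalSLE83Exists`) with law `μ = preWienerMeasure.map Γ`, a
probability measure by the proved Kolmogorov extension theorem; identify every subsequential weak
limit of the critical SAW laws with `μ` from the welding law (`WeldingLawOfLimit`), removability
(`RemovableLimit`, `SLERemovableChord`), welding rigidity (`WeldingSetup`, `WeldingRigidity`) and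
the one-sided Lusin–Souslin step (`IdentifyFromWelding`); upgrade by eventual tightness + Prokhorov
(`EventualTight`, `LimitUpgrade`)). The record is therefore closed by the term `closes`. No named
Literature fact is used; the axioms are those of `closes` (`propext`, `Classical.choice`,
`Quot.sound`).
-/

namespace Summit.CriticalPhenomena.SAWScalingLimit.Theorems

open Summit.CriticalPhenomena.SAWScalingLimit.Theses.SAWWeldingIdentification in
/-- **Item stmt-CriticalPhenomena-11048 (`Assembly`)**: the closing chain of route
`SAWWeldingIdentification`,
`WeldingLawOfLimit → RemovableLimit → EventualTight → WeldingSetup → WeldingRigidity →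
SLERemovableChord → IdentifyFromWelding → LimitUpgrade → ChordalSLE83Exists → SAWScalingLimit`,
proved by the route's deciding theorem `closes` (standard reductions: conformal-rectangle
completion, SLE_{8/3} reference curve, identification of subsequential limits from the welding law,
Prokhorov upgrade). [folklore] -/
theorem sawWeldingIdentification_assembly_proof :
    Summit.CriticalPhenomena.SAWScalingLimit.Theses.SAWWeldingIdentification.Assembly := by
  unfold Summit.CriticalPhenomena.SAWScalingLimit.Theses.SAWWeldingIdentification.Assembly
  exact closes

end Summit.CriticalPhenomena.SAWScalingLimit.Theorems
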